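import Literature.Topology.FourManifolds.SurfaceGroupNielsenCoreCuts
import Literature.Topology.FourManifolds.SurfaceGroupNielsenStatus
import HarnessLib

/-!
# Nielsen's theorem, pillar CORE: `NoDoublePointK` from the absence of double points

Topic `Literature/Topology/FourManifolds`.  The final book-keeping step of the CORE pillar in the
minimal-counterexample form: if NO potential-minimal configuration of a relator-killing,
indecomposable, marked non-trivial assignment admits a double point (`Config.DoublePoint`, two
positions `a < b < ℓ` of the closed path with the same prefix vertex) — which is what the case
files `SurfaceGroupNielsenCoreCase*.lean` establish, case by case —, then `NoDoublePointK g`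
holds: the cyclically reduced value of a minimal configuration is a simple circuit.  Indeed it is
a rotation of the closed path of the kernels (`exists_reduceCyclically_value_eq_rotate`), which
is non-empty, cyclically reduced, closed (the assignment kills the relator) and, absent double
points, has pairwise distinct prefix vertices; and rotations of simple circuits are simple
circuits.  Consequently (`nielsen_of_noDoublePoints_of_relatorEndIsAut`) Nielsen's theorem follows
from the absence of double points together with `RelatorEndIsAut` (landed separately as
`relatorEndIsAut_holds`, so in fact from the absence of double points alone).

## References

* H. Zieschang, E. Vogt, H.-D. Coldewey, *Surfaces and Planar Discontinuous Groups*, LNM 835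
  (1980), Thm. 5.3.2, Cor. 5.3.5, Thm. 5.6.1. [ZieschangVogtColdewey1980]
-/

noncomputable section

namespace Literature.Topology.FourManifolds

open Literature.GroupTheory.CombinatorialGroupTheory List

namespace SurfaceGroup

variable {g : ℕ}

/-- **No double points**: no potential-minimal configuration of a relator-killing,
indecomposable, marked non-trivial assignment has a double point on its closed path.
[cite: ZieschangVogtColdewey1980, Thm. 5.3.2] -/
def NoDoublePoints (g : ℕ) : Prop :=
  ∀ (φ : surfaceGen g → SurfaceGroup g), RelatorKilled φ → Indecomposable φ → MarkedNontrivial φ →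
    ∀ κ : Config φ, κ.IsMin → κ.DoublePoint → False

namespace Config

variable {φ : surfaceGen g → SurfaceGroup g}

/-- The value of a configuration of a relator-killing assignment is trivial in `S_g`. [folklore] -/
theorem proj_value (κ : Config φ) (hK : RelatorKilled φ) : proj g κ.value = 1 := by
  have h := DFunLike.congr_fun κ.proj_comp_lift (FreeGroup.mk κ.w)
  simp only [MonoidHom.coe_comp, Function.comp_apply, MulEquiv.coe_toMonoidHom] at h
  rw [value, h, κ.marking, map_mul, map_mul, map_inv]
  rw [RelatorKilled] at hK
  rw [hK, mul_one, mul_inv_cancel]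

/-- The closed path of a minimal configuration of a relator-killing assignment is closed in `S_g`.
[folklore] -/
theorem proj_mk_closedPath (κ : Config φ) (hK : RelatorKilled φ) (hg : 1 ≤ g) (hI : Indecomposable φ)
    (hM : MarkedNontrivial φ) (hmin : κ.IsMin) :
    proj g (FreeGroup.mk (CycFactors.closedPath κ.U)) = 1 := by
  have hd := κ.value_eq_conj_mk_closedPath hg hI hM hmin
  set d := FreeGroup.mk (CycFactors.head κ.U 0)
  have h := κ.proj_value hK
  rw [hd, map_mul, map_mul, map_inv] at h
  -- `p d * x * (p d)⁻¹ = 1 ⇒ x = 1`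
  have := congrArg (fun y => (proj g d)⁻¹ * y * proj g d) h
  simpa [mul_assoc] using this

/-- **The closed path of a minimal configuration without double point is a simple circuit.**
[cite: ZieschangVogtColdewey1980, Thm. 5.3.2] -/
theorem isSimpleCircuit_closedPath (κ : Config φ) (hK : RelatorKilled φ) (hg : 1 ≤ g)
    (hI : Indecomposable φ) (hM : MarkedNontrivial φ) (hmin : κ.IsMin)
    (hno : κ.DoublePoint → False) :
    IsSimpleCircuit (g := g) (CycFactors.closedPath κ.U) := by
  have hcyc := κ.isCyclicallyReduced_closedPath hg hI hM hmin
  refine ⟨?_, hcyc.isReduced, κ.proj_mk_closedPath hK hg hI hM hmin, ?_⟩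
  · exact CycFactors.CycNielsen.closedPath_ne_nil (κ.cycNielsen_U hg hI hM hmin) (κ.U_ne_nil hg)
  · intro k l hkl hl heq
    exact hno ⟨k, l, hkl, hl, heq⟩

end Config

/-- **`NoDoublePointK` from the absence of double points.** [cite: ZieschangVogtColdewey1980, Thm. 5.3.2 and Cor. 5.3.5] -/
theorem noDoublePointK_of_noDoublePoints (hg : 1 ≤ g) (hN : NoDoublePoints g) : NoDoublePointK g := by
  intro φ hK hI hM κ hmin
  obtain ⟨j, hj⟩ := κ.exists_reduceCyclically_value_eq_rotate hg hI hM hmin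
  rw [hj]
  exact simpleCircuitRotate_holds g _ j
    (κ.isSimpleCircuit_closedPath hK hg hI hM hmin (hN φ hK hI hM κ hmin))

/-- **Status with the double-point form**: Nielsen's theorem follows from the absence of double
points on minimal configurations and `RelatorEndIsAut`, for every `g ≥ 2`.
[cite: ZieschangVogtColdewey1980, Thm. 5.6.1] -/
theorem nielsen_of_noDoublePoints_of_relatorEndIsAut
    (hN : ∀ g : ℕ, 2 ≤ g → NoDoublePoints g) (hE : ∀ g : ℕ, 2 ≤ g → RelatorEndIsAut g) :
    nielsen_surfaceGroup_mulEquiv_lift :=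
  nielsen_of_noDoublePointK_of_relatorEndIsAut
    (fun g hg => noDoublePointK_of_noDoublePoints (by omega) (hN g hg)) hE

end SurfaceGroup

end Literature.Topology.FourManifolds

end
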